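import Summits.PneNP.PneNP.Theorems.PositionalGamesParityMonotoneQuasipolyUpperOrder
import Literature.Combinatorics.Games.UniversalTreesProofs
import Literature.Combinatorics.Games.UniversalTreesUpperProofs

/-!
# Progress-measure lifting: embeddings of ordered trees preserve truncated comparisons
(route PneNP/PositionalGames, support item stmt-PneNP-1298 `ParityMonotoneQuasipolyUpper`)

Lexicographic bookkeeping for the completeness proof: a common prefix cancels in lexicographic
comparisons; an isomorphic embedding of ordered trees (`OrderedTree.IsEmbedding`, Czerwiński et
al. 2019 §2.3) commutes with taking ancestors (`embedding_map_take`) and is strictly increasing on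
nodes of equal depth (`embedding_lt_of_lt`), hence preserves the truncated comparisons of
equal-depth nodes at every level (`embedding_take_lt_take`, `embedding_take_le_take`); and the
tree `prefixTree S` spanned by a finite set of sequences has height at most the common length
bound and at most `|S|` leaves.
-/

namespace Summit.PneNP.PneNP.Theorems.ParityLifting

set_option linter.dupNamespace false -- `Summit.PneNP.PneNP.…`: summit = sub-problem (D-0017)

open Literature.Combinatorics.Games

variable {U : Finset (List ℕ)} {V : Type*} [Fintype V]

/-! ## Completeness: lexicographic and embedding lemmas -/

section Embedding

/-- Appending to lists of equal length preserves a strict lexicographic comparison. -/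
theorem lex_append_of_length_eq : ∀ {z z' : List ℕ}, List.Lex (· < ·) z z' →
    z.length = z'.length → ∀ s s' : List ℕ, List.Lex (· < ·) (z ++ s) (z' ++ s')
  | _, _, .nil, hlen, _, _ => by simp at hlen
  | _, _, .rel hab, _, _, _ => List.Lex.rel hab
  | _, _, .cons h, hlen, s, s' =>
    List.Lex.cons (lex_append_of_length_eq h (by simpa using hlen) s s')

/-- Siblings compare by their last direction (converse of `OrderedTree.lex_append_singleton`). -/
theorem lt_of_append_singleton_lt {z : List ℕ} {a a' : ℕ} (h : z ++ [a] < z ++ [a']) : a < a' := by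
  by_contra hle
  rw [not_lt] at hle
  rcases hle.lt_or_eq with hlt | heq
  · exact lt_asymm h (OrderedTree.lex_append_singleton hlt)
  · rw [heq] at h
    exact lt_irrefl _ h

/-- A common prefix can be cancelled / added in a strict lexicographic comparison. -/
theorem append_lt_append_left_iff (pre a b : List ℕ) : pre ++ a < pre ++ b ↔ a < b := by
  constructor
  · intro h
    by_contra hle
    rw [not_lt] at hle
    rcases hle.lt_or_eq with hlt | heq
    · exact lt_asymm h (List.Lex.append_left _ hlt pre)
    · rw [heq] at h
      exact lt_irrefl _ h
  · intro h
    exact List.Lex.append_left _ h pre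

/-- A common prefix can be cancelled / added in a weak lexicographic comparison. -/
theorem append_le_append_left_iff (pre a b : List ℕ) : pre ++ a ≤ pre ++ b ↔ a ≤ b := by
  rw [← not_lt, ← not_lt, append_lt_append_left_iff]

variable {t T : OrderedTree} {f : List ℕ → List ℕ}

/-- An embedding commutes with taking ancestors. -/
theorem embedding_map_take (hf : OrderedTree.IsEmbedding t T f) :
    ∀ {y : List ℕ}, y ∈ t.nodes → ∀ i, f (y.take i) = (f y).take i := by
  intro y
  induction y using List.reverseRecOn with
  | nil => intro _ i; simp [hf.map_nil]
  | append_singleton z a ih =>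
    intro hy i
    have hz : z ∈ t.nodes := t.mem_of_isPrefix hy (List.prefix_append _ _)
    obtain ⟨b, hb⟩ := hf.map_child hy
    have hlenz : (f z).length = z.length := hf.length_eq hz
    by_cases hi : i ≤ z.length
    · rw [List.take_append_of_le_length hi, hb, List.take_append_of_le_length (by omega)]
      exact ih hz i
    · rw [List.take_of_length_le (by simp; omega), hb, List.take_of_length_le (by simp; omega)]

/-- An embedding is strictly increasing on nodes of equal depth. -/
theorem embedding_lt_of_lt (hf : OrderedTree.IsEmbedding t T f) :
    ∀ (n : ℕ) {y y' : List ℕ}, y ∈ t.nodes → y' ∈ t.nodes → y.length = n → y'.length = n →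
      y < y' → f y < f y' := by
  intro n
  induction n with
  | zero =>
    intro y y' _ _ hy hy' hlt
    rw [List.length_eq_zero_iff] at hy hy'
    subst hy; subst hy'
    exact absurd hlt (lt_irrefl _)
  | succ n ih =>
    intro y y' hy hy' hlen hlen' hlt
    obtain ⟨z, a, rfl⟩ : ∃ z a, y = z ++ [a] := by
      rcases List.eq_nil_or_concat y with h | ⟨z, a, h⟩
      · subst h; simp at hlen
      · exact ⟨z, a, by rw [h, List.concat_eq_append]⟩
    obtain ⟨z', a', rfl⟩ : ∃ z' a', y' = z' ++ [a'] := by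
      rcases List.eq_nil_or_concat y' with h | ⟨z', a', h⟩
      · subst h; simp at hlen'
      · exact ⟨z', a', by rw [h, List.concat_eq_append]⟩
    simp only [List.length_append, List.length_singleton, Nat.add_right_cancel_iff] at hlen hlen'
    have hz : z ∈ t.nodes := t.mem_of_isPrefix hy (List.prefix_append _ _)
    have hz' : z' ∈ t.nodes := t.mem_of_isPrefix hy' (List.prefix_append _ _)
    obtain ⟨b, hb⟩ := hf.map_child hy
    obtain ⟨b', hb'⟩ := hf.map_child hy'
    by_cases hzz : z = z'
    · subst hzz
      exact hf.strictMono hy hy' (lt_of_append_singleton_lt hlt)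
    · have hle : z ≤ z' := by
        have h1 := take_le_take_of_lt n hlt
        rwa [List.take_append_of_le_length (le_of_eq hlen.symm),
          List.take_append_of_le_length (le_of_eq hlen'.symm), List.take_of_length_le (le_of_eq hlen),
          List.take_of_length_le (le_of_eq hlen')] at h1
      have hzlt : z < z' := lt_of_le_of_ne hle hzz
      have h2 := ih hz hz' hlen hlen' hzlt
      rw [hb, hb']
      exact lex_append_of_length_eq h2
        (by rw [hf.length_eq hz, hf.length_eq hz', hlen, hlen']) _ _

/-- **Embeddings preserve truncated comparisons of equal-depth nodes** (strict). -/
theorem embedding_take_lt_take (hf : OrderedTree.IsEmbedding t T f) {y y' : List ℕ}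
    (hy : y ∈ t.nodes) (hy' : y' ∈ t.nodes) (hlen : y.length = y'.length) {i : ℕ}
    (h : y.take i < y'.take i) : (f y).take i < (f y').take i := by
  rw [← embedding_map_take hf hy, ← embedding_map_take hf hy']
  exact embedding_lt_of_lt hf (min i y.length) (t.mem_of_isPrefix hy (List.take_prefix _ _))
    (t.mem_of_isPrefix hy' (List.take_prefix _ _)) (List.length_take) (by rw [List.length_take, hlen]) h

/-- **Embeddings preserve truncated comparisons of equal-depth nodes** (weak). -/
theorem embedding_take_le_take (hf : OrderedTree.IsEmbedding t T f) {y y' : List ℕ}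
    (hy : y ∈ t.nodes) (hy' : y' ∈ t.nodes) (hlen : y.length = y'.length) {i : ℕ}
    (h : y.take i ≤ y'.take i) : (f y).take i ≤ (f y').take i := by
  rcases h.lt_or_eq with hlt | heq
  · exact (embedding_take_lt_take hf hy hy' hlen hlt).le
  · rw [← embedding_map_take hf hy, ← embedding_map_take hf hy', heq]

/-! ### The prefix tree -/

/-- Members of `S` are nodes of `prefixTree S`. -/
theorem mem_prefixTree {S : Finset (List ℕ)} {l : List ℕ} (hl : l ∈ S) : l ∈ (prefixTree S).nodes := by
  classical
  unfold prefixTree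
  simp only [Finset.mem_insert, Finset.mem_biUnion, Finset.mem_image, Finset.mem_range]
  exact Or.inr ⟨l, hl, l.length, Nat.lt_succ_self _, List.take_length⟩

/-- The height of `prefixTree S` is at most the common bound on the lengths. -/
theorem height_prefixTree_le {S : Finset (List ℕ)} {H : ℕ} (hS : ∀ l ∈ S, l.length ≤ H) :
    (prefixTree S).height ≤ H := by
  classical
  unfold OrderedTree.height prefixTree
  apply Finset.sup_le
  intro y hy
  simp only [Finset.mem_insert, Finset.mem_biUnion, Finset.mem_image, Finset.mem_range] at hy
  rcases hy with rfl | ⟨l, hl, i, _, rfl⟩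
  · simp
  · rw [List.length_take]
    exact (min_le_right _ _).trans (hS l hl)

/-- The leaves of `prefixTree S` are members of `S` (or the root). -/
theorem leaves_prefixTree_subset {S : Finset (List ℕ)} :
    (prefixTree S).leaves ⊆ insert [] S := by
  classical
  intro z hz
  rw [OrderedTree.mem_leaves] at hz
  obtain ⟨hz, hmax⟩ := hz
  have hz' := hz
  unfold prefixTree at hz'
  simp only [Finset.mem_insert, Finset.mem_biUnion, Finset.mem_image, Finset.mem_range] at hz'
  rcases hz' with rfl | ⟨l, hl, i, _, rfl⟩
  · exact Finset.mem_insert_self _ _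
  · have h := hmax l (mem_prefixTree hl) (List.take_prefix _ _)
    rw [Finset.mem_insert]
    exact Or.inr (h ▸ hl)

/-- Hence `prefixTree S` has at most `|S| + 1` leaves; sharper: at most `|S|` when `S` is nonempty. -/
theorem card_leaves_prefixTree_le {S : Finset (List ℕ)} (hS : S.Nonempty) :
    (prefixTree S).leaves.card ≤ S.card := by
  classical
  by_cases hnil : [] ∈ (prefixTree S).leaves
  · -- then the tree is the root alone, so every member of S is []
    have hall : ∀ l ∈ S, l = [] := fun l hl =>
      OrderedTree.eq_nil_of_nil_mem_leaves hnil (mem_prefixTree hl)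
    have h1 : (prefixTree S).leaves ⊆ {[]} := fun z hz =>
      Finset.mem_singleton.2 (OrderedTree.eq_nil_of_nil_mem_leaves hnil ((prefixTree S).leaves_subset hz))
    obtain ⟨l, hl⟩ := hS
    calc (prefixTree S).leaves.card ≤ ({[]} : Finset (List ℕ)).card := Finset.card_le_card h1
      _ = 1 := Finset.card_singleton _
      _ ≤ S.card := Finset.card_pos.2 ⟨l, hl⟩
  · apply Finset.card_le_card
    intro z hz
    have h := leaves_prefixTree_subset hz
    rw [Finset.mem_insert] at h
    rcases h with rfl | h
    · exact absurd hz hnil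
    · exact h

end Embedding

end Summit.PneNP.PneNP.Theorems.ParityLifting
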